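import Summits.HodgeConjecture.HodgeCM.PerL34.FockIrreducible_1

/-! PORT of `HodgeCM/PerL34/FockIrreducible.lean` (HodgeCMPerL run 82) — part 2: continuation of `Summits.HodgeConjecture.HodgeCM.PerL34.FockIrreducible_1` (split at a top-level declaration boundary by port_pkg.py; scope re-opened below; declarations unchanged). -/

-- port_pkg: scope re-opened for this part (file-level context, then the namespace/section stack open at the cut)
set_option autoImplicit false
namespace HodgeCM
namespace PerL34
namespace Fock
open MvPolynomial Finsupp
open scoped BigOperators
section Homogeneous
variable {σ : Type*} [Fintype σ] [DecidableEq σ]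
/-- Collecting: from any monomial of a polarisation-stable subspace to the pure power `X_a^{deg}`. -/
theorem single_degree_mem_of_mem (M : Submodule ℂ (MvPolynomial σ ℂ))
    (hM : ∀ a b, ∀ f ∈ M, X a * pderiv b f ∈ M) (a : σ) :
    ∀ (N : ℕ) (m : σ →₀ ℕ), m.degree ≤ m a + N → monomial m (1 : ℂ) ∈ M →
      monomial (single a m.degree) (1 : ℂ) ∈ M := by
  intro N
  induction N with
  | zero =>
    intro m hN hm
    rw [add_zero] at hN
    have hdeg : m.degree = m a := le_antisymm hN (le_degree a m)
    rw [hdeg, ← eq_single_of_degree_le hN]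
    exact hm
  | succ N ih =>
    intro m hN hm
    by_cases hle : m.degree ≤ m a + N
    · exact ih m hle hm
    · obtain ⟨i, hia, hi⟩ : ∃ i, i ≠ a ∧ m i ≠ 0 := by
        by_contra hcon
        push Not at hcon
        have := degree_le_of_forall_eq_zero (m := m) (a := a) hcon
        omega
      have hm' := monomial_move_mem M (hM a i) hm hi
      have hdeg := degree_move (m := m) a hi
      have hself := move_apply_self (m := m) (Ne.symm hia)
      have h3 := ih (single a 1 + (m - single i 1)) (by rw [hdeg, hself]; omega) hm'
      rwa [hdeg] at h3

/-- Distributing: from the pure power `X_a^{deg m}` to any monomial `m`. -/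
theorem mem_of_single_degree_mem (M : Submodule ℂ (MvPolynomial σ ℂ))
    (hM : ∀ a b, ∀ f ∈ M, X a * pderiv b f ∈ M) (a : σ) :
    ∀ (N : ℕ) (m : σ →₀ ℕ), m.degree ≤ m a + N → monomial (single a m.degree) (1 : ℂ) ∈ M →
      monomial m (1 : ℂ) ∈ M := by
  intro N
  induction N with
  | zero =>
    intro m hN hm
    rw [add_zero] at hN
    have hdeg : m.degree = m a := le_antisymm hN (le_degree a m)
    rw [eq_single_of_degree_le hN, ← hdeg]
    exact hm
  | succ N ih =>
    intro m hN hm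
    by_cases hle : m.degree ≤ m a + N
    · exact ih m hle hm
    · obtain ⟨i, hia, hi⟩ : ∃ i, i ≠ a ∧ m i ≠ 0 := by
        by_contra hcon
        push Not at hcon
        have := degree_le_of_forall_eq_zero (m := m) (a := a) hcon
        omega
      have hdeg := degree_move (m := m) a hi
      have hself := move_apply_self (m := m) (Ne.symm hia)
      have hm' : monomial (single a 1 + (m - single i 1)) (1 : ℂ) ∈ M :=
        ih (single a 1 + (m - single i 1)) (by rw [hdeg, hself]; omega) (by rw [hdeg]; exact hm)
      have hne : (single a 1 + (m - single i 1) : σ →₀ ℕ) a ≠ 0 := by rw [hself]; omega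
      have h3 := monomial_move_mem M (hM i a) hm' hne
      rwa [move_move a hi] at h3

/-- **`Sym^d(ℂ^σ)` is `𝔤𝔩(σ)`-irreducible**, in invariant-subspace form: a subspace of `ℂ[X_σ]` stable under all
polarisations `X_a ∂_b` which contains ONE non-zero homogeneous polynomial of degree `d` contains EVERY homogeneous
polynomial of degree `d`.  (For `σ = Fin 3` this is Howe duality for the compact pair `(U(1), U(3))`, §4.) -/
theorem wpiece_one_le_of_stable (M : Submodule ℂ (MvPolynomial σ ℂ))
    (hM : ∀ a b, ∀ f ∈ M, X a * pderiv b f ∈ M) {v : MvPolynomial σ ℂ} (hvM : v ∈ M) (hv : v ≠ 0)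
    {d : ℕ} (hvd : v ∈ wpiece (fun _ => (1 : ℤ)) (d : ℤ)) : wpiece (fun _ => (1 : ℤ)) (d : ℤ) ≤ M := by
  obtain ⟨m₀, hm₀⟩ : v.support.Nonempty := by
    rw [Finset.nonempty_iff_ne_empty, Ne, MvPolynomial.support_eq_empty]
    exact hv
  have hm₀M : monomial m₀ (1 : ℂ) ∈ M := monomial_mem_of_eulerStable M (fun i => hM i i) hvM hm₀
  have hd₀ : m₀.degree = d := by
    have h1 := (mem_wpiece_iff_support _ _ _).mp hvd m₀ hm₀
    rw [wt_one] at h1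
    exact_mod_cast h1
  intro f hf
  refine mem_of_monomial_mem M fun m hm => ?_
  have hd : m.degree = d := by
    have h1 := (mem_wpiece_iff_support _ _ _).mp hf m hm
    rw [wt_one] at h1
    exact_mod_cast h1
  by_cases hσ : Nonempty σ
  · obtain ⟨a⟩ := hσ
    have h1 := single_degree_mem_of_mem M hM a m₀.degree m₀ (by omega) hm₀M
    rw [hd₀, ← hd] at h1
    exact mem_of_single_degree_mem M hM a m.degree m (by omega) h1
  · have : m = m₀ := by
      ext i
      exact absurd ⟨i⟩ hσ
    rw [this]
    exact hm₀M

end Homogeneous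

/-! ## 3. The pair `(U(1), U(2,1))`: the one-line model `ℂ[z₁, z₂, w]` at `ι₁` (pv12's `HarmModel`, (F2)/(F3)) -/

section Harmonic

/-! ### 3.1 The nine operators spanning the image of `𝔤′ = 𝔤𝔩₃ = 𝔲(2,1)_ℂ` -/

/-- `𝔨′ ⊃ 𝔤𝔩₂ = 𝔲(2)_ℂ` (the `V⁺` block): `E_{ab} = z_a ∂_{z_b}` (`hEplus = hE 0 1`; the torus `E_{aa}` up to the
vacuum shift, which is immaterial for stable subspaces: `stable_shift_iff`). -/
noncomputable def hE (a b : Fin 2) : HarmModel →ₗ[ℂ] HarmModel where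
  toFun f := hz a * pderiv (Sum.inl b) f
  map_add' f g := by simp only [map_add, mul_add]
  map_smul' r f := by simp only [Derivation.map_smul, mul_smul_comm, RingHom.id_apply]

/-- (Ported verbatim from the HodgeCMPerL package; no docstring in the source.) -/
theorem hE_apply (a b : Fin 2) (f : HarmModel) : hE a b f = X (Sum.inl a) * pderiv (Sum.inl b) f := rfl

/-- (Ported verbatim from the HodgeCMPerL package; no docstring in the source.) -/
theorem hEplus_eq : hEplus = hE 0 1 := rfl

/-- `𝔨′ ⊃ 𝔤𝔩₁ = 𝔲(1)_ℂ` (the `V⁻` block): `H = w ∂_w` (up to the vacuum shift). -/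
noncomputable def hH : HarmModel →ₗ[ℂ] HarmModel where
  toFun f := hw * pderiv (Sum.inr ()) f
  map_add' f g := by simp only [map_add, mul_add]
  map_smul' r f := by simp only [Derivation.map_smul, mul_smul_comm, RingHom.id_apply]

/-- (Ported verbatim from the HodgeCMPerL package; no docstring in the source.) -/
theorem hH_apply (f : HarmModel) : hH f = X (Sum.inr ()) * pderiv (Sum.inr ()) f := rfl

/-- `𝔭′⁺` (raising the degree by `2`): `P_a =` multiplication by `z_a w`. -/
noncomputable def hP (a : Fin 2) : HarmModel →ₗ[ℂ] HarmModel := LinearMap.mulLeft ℂ (hz a * hw)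

/-- (Ported verbatim from the HodgeCMPerL package; no docstring in the source.) -/
theorem hP_apply (a : Fin 2) (f : HarmModel) : hP a f = hz a * hw * f := rfl

/-- `𝔭′⁻` (lowering the degree by `2`): `Q_a = ∂_{z_a} ∂_w`. -/
noncomputable def hQ (a : Fin 2) : HarmModel →ₗ[ℂ] HarmModel where
  toFun f := pderiv (Sum.inl a) (pderiv (Sum.inr ()) f)
  map_add' f g := by simp only [map_add]
  map_smul' r f := by simp only [Derivation.map_smul, RingHom.id_apply]

/-- (Ported verbatim from the HodgeCMPerL package; no docstring in the source.) -/
theorem hQ_apply (a : Fin 2) (f : HarmModel) : hQ a f = pderiv (Sum.inl a) (pderiv (Sum.inr ()) f) := rfl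

/-- Index set of the nine operators. -/
inductive GOp : Type
  | E (a b : Fin 2)
  | H
  | P (a : Fin 2)
  | Q (a : Fin 2)

/-- The operator family `𝔤′ → End(ℂ[z₁,z₂,w])` on its basis. -/
noncomputable def gop : GOp → HarmModel →ₗ[ℂ] HarmModel
  | .E a b => hE a b
  | .H => hH
  | .P a => hP a
  | .Q a => hQ a

/-- Stable under (the image of) `𝔨′ = 𝔤𝔩₂ ⊕ 𝔤𝔩₁`. -/
def IsKStable (M : Submodule ℂ HarmModel) : Prop :=
  (∀ a b, ∀ f ∈ M, hE a b f ∈ M) ∧ ∀ f ∈ M, hH f ∈ M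

/-- Stable under (the image of) `𝔤′ = 𝔨′ ⊕ 𝔭′⁺ ⊕ 𝔭′⁻`. -/
def IsGStable (M : Submodule ℂ HarmModel) : Prop :=
  IsKStable M ∧ (∀ a, ∀ f ∈ M, hP a f ∈ M) ∧ ∀ a, ∀ f ∈ M, hQ a f ∈ M

/-- (Ported verbatim from the HodgeCMPerL package; no docstring in the source.) -/
theorem isGStable_iff (M : Submodule ℂ HarmModel) : IsGStable M ↔ ∀ o, ∀ f ∈ M, gop o f ∈ M := by
  constructor
  · rintro ⟨⟨hE', hH'⟩, hP', hQ'⟩ o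
    cases o with
    | E a b => exact hE' a b
    | H => exact hH'
    | P a => exact hP' a
    | Q a => exact hQ' a
  · intro h
    exact ⟨⟨fun a b => h (.E a b), h .H⟩, fun a => h (.P a), fun a => h (.Q a)⟩

/-- A `𝔨′`-stable (a fortiori a `𝔤′`-stable) subspace is stable under the Euler operators of all three variables. -/
theorem IsKStable.euler {M : Submodule ℂ HarmModel} (hM : IsKStable M) :
    ∀ i, ∀ f ∈ M, X i * pderiv i f ∈ M := by
  rintro (a | u) f hf
  · exact hM.1 a a f hf
  · exact hM.2 f hf

/-! ### 3.2 The `U(1)`-isotypic pieces `F_k` and exponent bookkeeping -/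

/-- The `U(1)_W`-isotypic piece of weight `k ∈ ℤ` (`z_a ↦ u z_a`, `w ↦ u⁻¹ w`, (F2)): `F_k = wpiece uWt k`, spanned
by the `z^α w^e` with `|α| − e = k`.  `F_1` is PerL's `J⁺`-piece `InJplus` (`inJplus_iff`). -/
noncomputable abbrev hpiece (k : ℤ) : Submodule ℂ HarmModel := wpiece uWt k

/-- (Ported verbatim from the HodgeCMPerL package; no docstring in the source.) -/
theorem wt_uWt' (m : HarmVar →₀ ℕ) :
    wt uWt m = (m (Sum.inl 0) : ℤ) + m (Sum.inl 1) - m (Sum.inr ()) := by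
  simp only [wt, uWt, Fintype.sum_sum_type, Fin.sum_univ_two, Fintype.sum_unique]
  ring

/-- (Ported verbatim from the HodgeCMPerL package; no docstring in the source.) -/
theorem degree_harmVar (m : HarmVar →₀ ℕ) : m.degree = m (Sum.inl 0) + m (Sum.inl 1) + m (Sum.inr ()) := by
  rw [degree_eq_sum, Fintype.sum_sum_type, Fin.sum_univ_two, Fintype.sum_unique]

/-- (Ported verbatim from the HodgeCMPerL package; no docstring in the source.) -/
theorem inJplus_iff (f : HarmModel) : InJplus f ↔ f ∈ hpiece 1 := by
  rw [InJplus, mem_wpiece_iff, Int.cast_one, one_smul]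

/-- (Ported verbatim from the HodgeCMPerL package; no docstring in the source.) -/
theorem mem_hpiece_iff (k : ℤ) (f : HarmModel) :
    f ∈ hpiece k ↔ ∀ m ∈ f.support, (m (Sum.inl 0) : ℤ) + m (Sum.inl 1) - m (Sum.inr ()) = k := by
  rw [mem_wpiece_iff_support]
  simp only [wt_uWt']

/-- Exponent vector of `z₁^a z₂^b w^e`. -/
noncomputable def hexp (a b e : ℕ) : HarmVar →₀ ℕ :=
  single (Sum.inl 0) a + single (Sum.inl 1) b + single (Sum.inr ()) e

/-- (Ported verbatim from the HodgeCMPerL package; no docstring in the source.) -/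
@[simp] theorem hexp_inl_zero (a b e : ℕ) : hexp a b e (Sum.inl 0) = a := by
  simp [hexp]

/-- (Ported verbatim from the HodgeCMPerL package; no docstring in the source.) -/
@[simp] theorem hexp_inl_one (a b e : ℕ) : hexp a b e (Sum.inl 1) = b := by
  simp [hexp]

/-- (Ported verbatim from the HodgeCMPerL package; no docstring in the source.) -/
@[simp] theorem hexp_inr (a b e : ℕ) : hexp a b e (Sum.inr ()) = e := by
  simp [hexp]

/-- (Ported verbatim from the HodgeCMPerL package; no docstring in the source.) -/
theorem eq_hexp_iff {m : HarmVar →₀ ℕ} {a b e : ℕ} :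
    m = hexp a b e ↔ m (Sum.inl 0) = a ∧ m (Sum.inl 1) = b ∧ m (Sum.inr ()) = e := by
  constructor
  · rintro rfl; simp
  · rintro ⟨h0, h1, h2⟩
    ext v
    rcases v with c | u
    · fin_cases c
      · simpa using h0
      · simpa using h1
    · obtain ⟨⟩ := u
      simpa using h2

/-- (Ported verbatim from the HodgeCMPerL package; no docstring in the source.) -/
theorem hexp_eta (m : HarmVar →₀ ℕ) : hexp (m (Sum.inl 0)) (m (Sum.inl 1)) (m (Sum.inr ())) = m :=
  (eq_hexp_iff.mpr ⟨rfl, rfl, rfl⟩).symm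

/-- (Ported verbatim from the HodgeCMPerL package; no docstring in the source.) -/
theorem wt_uWt_hexp (a b e : ℕ) : wt uWt (hexp a b e) = (a : ℤ) + b - e := by
  rw [wt_uWt']; simp

/-- (Ported verbatim from the HodgeCMPerL package; no docstring in the source.) -/
theorem degree_hexp (a b e : ℕ) : (hexp a b e).degree = a + b + e := by
  rw [degree_harmVar]; simp

/-- (Ported verbatim from the HodgeCMPerL package; no docstring in the source.) -/
theorem hexp_succ_left (a b e : ℕ) : hexp (a + 1) b e = hexp a b e + single (Sum.inl 0) 1 := by
  simp only [hexp, single_add]; abel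

/-- (Ported verbatim from the HodgeCMPerL package; no docstring in the source.) -/
theorem hexp_succ_mid (a b e : ℕ) : hexp a (b + 1) e = hexp a b e + single (Sum.inl 1) 1 := by
  simp only [hexp, single_add]; abel

/-- (Ported verbatim from the HodgeCMPerL package; no docstring in the source.) -/
theorem hexp_succ_right (a b e : ℕ) : hexp a b (e + 1) = hexp a b e + single (Sum.inr ()) 1 := by
  simp only [hexp, single_add]; abel

/-- exponent bookkeeping of the four moves used below -/
theorem hexp_move01 (a b e : ℕ) :
    single (Sum.inl 0) 1 + (hexp a (b + 1) e - single (Sum.inl 1) 1) = hexp (a + 1) b e := by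
  rw [hexp_succ_mid, add_tsub_cancel_right, hexp_succ_left, add_comm]

/-- (Ported verbatim from the HodgeCMPerL package; no docstring in the source.) -/
theorem hexp_move10 (a b e : ℕ) :
    single (Sum.inl 1) 1 + (hexp (a + 1) b e - single (Sum.inl 0) 1) = hexp a (b + 1) e := by
  rw [hexp_succ_left, add_tsub_cancel_right, hexp_succ_mid, add_comm]

/-- (Ported verbatim from the HodgeCMPerL package; no docstring in the source.) -/
theorem hexp_moveP0 (a b e : ℕ) :
    single (Sum.inl 0) 1 + single (Sum.inr ()) 1 + hexp a b e = hexp (a + 1) b (e + 1) := by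
  rw [hexp_succ_right, hexp_succ_left]; abel

/-- (Ported verbatim from the HodgeCMPerL package; no docstring in the source.) -/
theorem hexp_moveP1 (a b e : ℕ) :
    single (Sum.inl 1) 1 + single (Sum.inr ()) 1 + hexp a b e = hexp a (b + 1) (e + 1) := by
  rw [hexp_succ_right, hexp_succ_mid]; abel

/-- (Ported verbatim from the HodgeCMPerL package; no docstring in the source.) -/
theorem hexp_moveQ0 (a b e : ℕ) :
    hexp (a + 1) b (e + 1) - single (Sum.inr ()) 1 - single (Sum.inl 0) 1 = hexp a b e := by
  rw [hexp_succ_right, add_tsub_cancel_right, hexp_succ_left, add_tsub_cancel_right]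

/-- The monomial `z₁^a z₂^b w^e`. -/
noncomputable def hmon (a b e : ℕ) : HarmModel := monomial (hexp a b e) 1

/-- (Ported verbatim from the HodgeCMPerL package; no docstring in the source.) -/
theorem hmon_mem_hpiece (a b e : ℕ) : hmon a b e ∈ hpiece ((a : ℤ) + b - e) :=
  monomial_mem_wpiece (wt_uWt_hexp a b e) 1

/-- (Ported verbatim from the HodgeCMPerL package; no docstring in the source.) -/
theorem hmon_ne_zero (a b e : ℕ) : hmon a b e ≠ 0 := by
  rw [hmon, Ne, monomial_eq_zero]; exact one_ne_zero

/-- (Ported verbatim from the HodgeCMPerL package; no docstring in the source.) -/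
theorem hz_zero_eq : hz 0 = hmon 1 0 0 := by
  rw [hmon, hexp, single_zero, single_zero, add_zero, add_zero]; rfl

/-- (Ported verbatim from the HodgeCMPerL package; no docstring in the source.) -/
theorem hz_one_eq : hz 1 = hmon 0 1 0 := by
  rw [hmon, hexp, single_zero, single_zero, zero_add, add_zero]; rfl

/-- (Ported verbatim from the HodgeCMPerL package; no docstring in the source.) -/
theorem hw_pow_eq (n : ℕ) : hw ^ n = hmon 0 0 n := by
  rw [hmon, hexp, single_zero, single_zero, zero_add, zero_add, hw, X_pow_eq_monomial]

/-! ### 3.3 The operators on monomials -/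

/-- (Ported verbatim from the HodgeCMPerL package; no docstring in the source.) -/
theorem hE_monomial (a b : Fin 2) (m : HarmVar →₀ ℕ) (c : ℂ) :
    hE a b (monomial m c) =
      ((m (Sum.inl b) : ℕ) : ℂ) • monomial (single (Sum.inl a) 1 + (m - single (Sum.inl b) 1)) c :=
  X_mul_pderiv_monomial' _ _ m c

/-- (Ported verbatim from the HodgeCMPerL package; no docstring in the source.) -/
theorem hH_monomial (m : HarmVar →₀ ℕ) (c : ℂ) :
    hH (monomial m c) = ((m (Sum.inr ()) : ℕ) : ℂ) • monomial m c := by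
  rw [hH_apply, X_mul_pderiv_monomial']
  by_cases h : m (Sum.inr ()) = 0
  · rw [h, Nat.cast_zero, zero_smul, zero_smul]
  · rw [add_comm (single _ 1), tsub_add_cancel_of_le (single_le_iff.mpr (Nat.one_le_iff_ne_zero.mpr h))]

/-- (Ported verbatim from the HodgeCMPerL package; no docstring in the source.) -/
theorem hP_monomial (a : Fin 2) (m : HarmVar →₀ ℕ) (c : ℂ) :
    hP a (monomial m c) = monomial (single (Sum.inl a) 1 + single (Sum.inr ()) 1 + m) c := by
  rw [hP_apply, hz, hw, X, X, monomial_mul, monomial_mul, one_mul, one_mul]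

/-- (Ported verbatim from the HodgeCMPerL package; no docstring in the source.) -/
theorem hQ_monomial (a : Fin 2) (m : HarmVar →₀ ℕ) (c : ℂ) :
    hQ a (monomial m c) = ((m (Sum.inl a) * m (Sum.inr ()) : ℕ) : ℂ) •
      monomial (m - single (Sum.inr ()) 1 - single (Sum.inl a) 1) c := by
  rw [hQ_apply, pderiv_monomial, pderiv_monomial, smul_monomial, smul_eq_mul]
  congr 1
  rw [Finsupp.tsub_apply, single_apply, if_neg Sum.inr_ne_inl, tsub_zero]
  push_cast
  ring

/-- (Ported verbatim from the HodgeCMPerL package; no docstring in the source.) -/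
theorem coeff_hQ (a : Fin 2) (f : HarmModel) (n : HarmVar →₀ ℕ) :
    coeff n (hQ a f) = ((n (Sum.inl a) + 1 : ℕ) : ℂ) * ((n (Sum.inr ()) + 1 : ℕ) : ℂ) *
      coeff (n + single (Sum.inl a) 1 + single (Sum.inr ()) 1) f := by
  rw [hQ_apply, coeff_pderiv, coeff_pderiv, Finsupp.add_apply, single_apply, if_neg Sum.inl_ne_inr,
    add_zero]
  push_cast
  ring

/-- (Ported verbatim from the HodgeCMPerL package; no docstring in the source.) -/
theorem hE01_hmon (a b e : ℕ) : hE 0 1 (hmon a (b + 1) e) = ((b + 1 : ℕ) : ℂ) • hmon (a + 1) b e := by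
  rw [hmon, hmon, hE_monomial, hexp_inl_one, hexp_move01]

/-- (Ported verbatim from the HodgeCMPerL package; no docstring in the source.) -/
theorem hE10_hmon (a b e : ℕ) : hE 1 0 (hmon (a + 1) b e) = ((a + 1 : ℕ) : ℂ) • hmon a (b + 1) e := by
  rw [hmon, hmon, hE_monomial, hexp_inl_zero, hexp_move10]

/-- (Ported verbatim from the HodgeCMPerL package; no docstring in the source.) -/
theorem hP0_hmon (a b e : ℕ) : hP 0 (hmon a b e) = hmon (a + 1) b (e + 1) := by
  rw [hmon, hmon, hP_monomial, hexp_moveP0]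

/-- (Ported verbatim from the HodgeCMPerL package; no docstring in the source.) -/
theorem hP1_hmon (a b e : ℕ) : hP 1 (hmon a b e) = hmon a (b + 1) (e + 1) := by
  rw [hmon, hmon, hP_monomial, hexp_moveP1]

/-- (Ported verbatim from the HodgeCMPerL package; no docstring in the source.) -/
theorem hQ0_hmon (a b e : ℕ) :
    hQ 0 (hmon (a + 1) b (e + 1)) = (((a + 1) * (e + 1) : ℕ) : ℂ) • hmon a b e := by
  rw [hmon, hmon, hQ_monomial, hexp_inl_zero, hexp_inr, hexp_moveQ0]


/-! ### 3.4 Each `F_k` is a `𝔤′`-submodule -/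


-- port_pkg: scope closed for this part
end Harmonic
end Fock
end PerL34
end HodgeCM
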